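import Mathlib
import HarnessLib
import Summits.Ventures.LatticeQCDFlow.Scoring.UStatisticStrongLaw

/-!
# Row means of an order-2 U-statistic: the deterministic algebra of Sen's variance estimator
# (`Σᵢ Ĥᵢ/n = Uₙ`, `Ĥᵢ = h(xᵢ) + ẽᵢ`, the Cauchy–Schwarz perturbation bound) and the
# CONDITIONALLY CENTRED kernel `G̃(a, b) = F(a, b) − h(a)`

HONEST FRAMING: exact (Metropolis-corrected) sampling algorithms for lattice gauge theory;
figures of merit are autocorrelation/cost numbers at stated couplings and volumes; no
continuum-physics claim.

Venture `LatticeQCDFlow` (cell pub-lqcd), topic `Scoring`; FANOUT row 4 (`s0-u1-b`, rung S0-B).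
Support file for `Scoring/UStatisticVarianceEstimator` (Sen's estimator
`V̂ₙ = (1/n) Σᵢ (Ĥᵢ − Uₙ)²` of the projection variance `ζ₁` of Hoeffding's CLT is consistent
in probability).  Everything here is either finite-sum algebra about the ROW MEANS
`Ĥᵢ = Σ_{j<n, j≠i} F(xᵢ, xⱼ)/(n − 1)` of a kernel evaluated on `n` points, or the three facts
about the conditionally centred kernel `G̃(a, b) = F(a, b) − h(a)` (`h(a) = ∫ F(a, b) dν(b)`
Hoeffding's projection) that drive the probabilistic estimate: `G̃` is measurable, square-
integrable under the pair law, and `∫ G̃(a, b) dν(b) = 0` for EVERY `a` (also where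
`F(a, ·) ∉ L¹(ν)`, by Lean's `∫ = 0` convention on both sides).  The decomposition is
`Ĥᵢ = h(xᵢ) + ẽᵢ`, `ẽᵢ = Σ_{j≠i} G̃(xᵢ, xⱼ)/(n − 1)`, and since the `Ĥᵢ` average to `Uₙ`
EXACTLY, `V̂ₙ = (1/n)Σᵢ Ĥᵢ² − Uₙ²`; the mean square of `h(xᵢ) + ẽᵢ` differs from that of `h(xᵢ)`
by at most `2√(MS(h)·MS(ẽ)) + MS(ẽ)` (Cauchy–Schwarz, `Finset.sum_mul_sq_le_sq_mul_sq`), whence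
the deterministic comparison **`senVariance_sub_le`** and the real-analysis squeeze
**`tendsto_senVariance_along`** used by the next file.  Printed counterparts NAMED ONLY: Sen,
Calcutta Statist. Assoc. Bull. 10 (1960) 1–18; Arvesen, Ann. Math. Statist. 40 (1969)
2076–2100; Serfling (1980) §5.7.  NEW WORK of the cell (elementary); no definition is introduced;
row 3's `Scoring/UStatisticProjectionsIntegral` (via `Scoring/UStatisticStrongLaw`) supplies
`h ∈ L²(ν)`.

## Content (`Uₙ = Σ_{i≠j} f_{ij}/(n(n−1))`, `Ĥᵢ = Σ_{j≠i} f_{ij}/(n−1)`, `MS(v) = Σᵢ vᵢ²/n`)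

§1 `sum_offDiag_eq_sum_sum_erase`, `sum_rowMean_div_eq_ustat` (`Σᵢ Ĥᵢ/n = Uₙ`),
`empVar_eq_meanSq_sub_sq`, `rowMean_eq_add_err`, **`abs_meanSq_add_sub_meanSq_le`**,
**`senVariance_sub_le`** (`|V̂ₙ − (MS(h) − Uₙ²)| ≤ 2√(MS(h)MS(ẽ)) + MS(ẽ)`),
**`tendsto_senVariance_along`**.
§2 `measurable_centredKernel`, `memLp_centredKernel_two`,
**`integral_centredKernel_section_eq_zero`**, `integral_sq_centredKernel_section_eq_zero`.

NOT CLAIMED: anything probabilistic (next file); higher-order kernels; any number of ours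
re-scored.
-/

noncomputable section

namespace Summit.Ventures.LatticeQCDFlow.Scoring.CardConsistency

open MeasureTheory ProbabilityTheory Finset Real Filter
open scoped Topology Function ENNReal

/-! ## §1 Deterministic bookkeeping -/

section Deterministic

/-- `Σ_{(i,j) ∈ offDiag} f(i, j) = Σᵢ Σ_{j ≠ i} f(i, j)`. [folklore] -/
theorem sum_offDiag_eq_sum_sum_erase {n : ℕ} (f : Fin n → Fin n → ℝ) :
    ∑ z ∈ (univ : Finset (Fin n)).offDiag, f z.1 z.2 = ∑ i, ∑ j ∈ univ.erase i, f i j := by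
  have h1 : ∀ i : Fin n, ∑ j ∈ univ.erase i, f i j = ∑ j, if i ≠ j then f i j else 0 := by
    intro i
    rw [← Finset.sum_filter, Finset.filter_ne]
  simp_rw [h1]
  rw [← Finset.sum_product', ← Finset.sum_filter]
  refine Finset.sum_congr ?_ fun _ _ => rfl
  ext z
  simp [mem_offDiag]

/-- **The row means average to the U-statistic**: `(Σᵢ Ĥᵢ)/n = Uₙ`. [ours] -/
theorem sum_rowMean_div_eq_ustat {n : ℕ} (f : Fin n → Fin n → ℝ) :
    (∑ i, (∑ j ∈ univ.erase i, f i j) / ((n : ℝ) - 1)) / (n : ℝ)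
      = (∑ z ∈ (univ : Finset (Fin n)).offDiag, f z.1 z.2) / (n * (n - 1) : ℝ) := by
  rw [sum_offDiag_eq_sum_sum_erase, ← sum_div, div_div, mul_comm]

/-- **The empirical variance about the mean is the mean square minus the squared mean**: for
`n ≥ 1` and `c = (Σᵢ vᵢ)/n`, `Σᵢ (vᵢ − c)²/n = Σᵢ vᵢ²/n − c²`. [folklore] -/
theorem empVar_eq_meanSq_sub_sq {n : ℕ} (hn : 1 ≤ n) (v : Fin n → ℝ) {c : ℝ}
    (hc : c = (∑ i, v i) / (n : ℝ)) :
    (∑ i, (v i - c) ^ 2) / (n : ℝ) = (∑ i, v i ^ 2) / (n : ℝ) - c ^ 2 := by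
  have hn0 : (n : ℝ) ≠ 0 := by positivity
  have hs : ∑ i, v i = n * c := by
    rw [hc, mul_div_cancel₀ _ hn0]
  have e : ∑ i, (v i - c) ^ 2 = ∑ i, v i ^ 2 - 2 * c * ∑ i, v i + n * c ^ 2 := by
    rw [Finset.mul_sum, show (n : ℝ) * c ^ 2 = ∑ _i : Fin n, c ^ 2 by simp,
      ← Finset.sum_sub_distrib, ← Finset.sum_add_distrib]
    exact Finset.sum_congr rfl fun i _ => by ring
  rw [e, hs]
  field_simp
  ring

/-- **Row mean = projection + error**: for `n ≥ 2` and any reals `hᵢ`,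
`Σ_{j≠i} f_{ij}/(n−1) = hᵢ + Σ_{j≠i} (f_{ij} − hᵢ)/(n−1)`. [ours] -/
theorem rowMean_eq_add_err {n : ℕ} (hn : 2 ≤ n) (f : Fin n → Fin n → ℝ) (hv : Fin n → ℝ)
    (i : Fin n) :
    (∑ j ∈ univ.erase i, f i j) / ((n : ℝ) - 1)
      = hv i + (∑ j ∈ univ.erase i, (f i j - hv i)) / ((n : ℝ) - 1) := by
  have h2 : (2 : ℝ) ≤ n := by exact_mod_cast hn
  have hn1 : (n : ℝ) - 1 ≠ 0 := by
    intro h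
    linarith
  have hcard : ((univ.erase i).card : ℝ) = n - 1 := by
    rw [card_erase_of_mem (mem_univ i), card_univ, Fintype.card_fin, Nat.cast_sub (by omega),
      Nat.cast_one]
  rw [sum_sub_distrib, sum_const, nsmul_eq_mul, hcard]
  field_simp
  ring

/-- **Perturbation of a mean square** (Cauchy–Schwarz): for `n ≥ 1` and reals `aᵢ`, `eᵢ`, with
`MS(v) = Σᵢ vᵢ²/n`: `|MS(a + e) − MS(a)| ≤ 2√(MS(a)·MS(e)) + MS(e)`. [ours] -/
theorem abs_meanSq_add_sub_meanSq_le {n : ℕ} (hn : 1 ≤ n) (a e : Fin n → ℝ) :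
    |(∑ i, (a i + e i) ^ 2) / (n : ℝ) - (∑ i, a i ^ 2) / (n : ℝ)|
      ≤ 2 * Real.sqrt ((∑ i, a i ^ 2) / (n : ℝ) * ((∑ i, e i ^ 2) / (n : ℝ)))
        + (∑ i, e i ^ 2) / (n : ℝ) := by
  have hn0 : (0 : ℝ) < n := by exact_mod_cast hn
  have hE0 : 0 ≤ ∑ i, e i ^ 2 := sum_nonneg fun i _ => sq_nonneg _
  -- expand the square
  have e1 : ∑ i, (a i + e i) ^ 2 = ∑ i, a i ^ 2 + 2 * ∑ i, a i * e i + ∑ i, e i ^ 2 := by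
    rw [Finset.mul_sum, ← Finset.sum_add_distrib, ← Finset.sum_add_distrib]
    exact Finset.sum_congr rfl fun i _ => by ring
  have hexp : (∑ i, (a i + e i) ^ 2) / (n : ℝ) - (∑ i, a i ^ 2) / (n : ℝ)
      = 2 * ((∑ i, a i * e i) / n) + (∑ i, e i ^ 2) / n := by
    rw [e1]
    field_simp
    ring
  -- Cauchy–Schwarz for the cross term
  have hcs : |(∑ i, a i * e i) / n| ≤ Real.sqrt ((∑ i, a i ^ 2) / n * ((∑ i, e i ^ 2) / n)) := by
    rw [abs_div, abs_of_pos hn0]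
    have h1 : |∑ i, a i * e i| ≤ Real.sqrt ((∑ i, a i ^ 2) * ∑ i, e i ^ 2) :=
      Real.abs_le_sqrt (sum_mul_sq_le_sq_mul_sq _ _ _)
    have h2 : Real.sqrt ((∑ i, a i ^ 2) / n * ((∑ i, e i ^ 2) / n))
        = Real.sqrt ((∑ i, a i ^ 2) * ∑ i, e i ^ 2) / n := by
      rw [div_mul_div_comm, ← sq, Real.sqrt_div' _ (sq_nonneg _), Real.sqrt_sq hn0.le]
    rw [h2]
    exact div_le_div_of_nonneg_right h1 hn0.le
  rw [hexp]
  calc |2 * ((∑ i, a i * e i) / n) + (∑ i, e i ^ 2) / n|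
      ≤ |2 * ((∑ i, a i * e i) / n)| + |(∑ i, e i ^ 2) / n| := abs_add_le _ _
    _ = 2 * |(∑ i, a i * e i) / n| + (∑ i, e i ^ 2) / n := by
        rw [abs_mul, abs_two, abs_of_nonneg (div_nonneg hE0 hn0.le)]
    _ ≤ 2 * Real.sqrt ((∑ i, a i ^ 2) / n * ((∑ i, e i ^ 2) / n)) + (∑ i, e i ^ 2) / n := by
        linarith [hcs]

/-- **Sen's estimator versus the oracle empirical variance** (deterministic, `n ≥ 2`): with
`Uₙ = Σ_{i≠j} f_{ij}/(n(n−1))`, row means `Ĥᵢ = Σ_{j≠i} f_{ij}/(n−1)`, any reals `hᵢ` and errors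
`ẽᵢ = Σ_{j≠i}(f_{ij} − hᵢ)/(n−1)`:
`|Σᵢ(Ĥᵢ − Uₙ)²/n − (Σᵢ hᵢ²/n − Uₙ²)| ≤ 2√((Σᵢ hᵢ²/n)(Σᵢ ẽᵢ²/n)) + Σᵢ ẽᵢ²/n`. [ours] -/
theorem senVariance_sub_le {n : ℕ} (hn : 2 ≤ n) (f : Fin n → Fin n → ℝ) (hv : Fin n → ℝ) :
    |(∑ i, ((∑ j ∈ univ.erase i, f i j) / ((n : ℝ) - 1)
          - (∑ z ∈ (univ : Finset (Fin n)).offDiag, f z.1 z.2) / (n * (n - 1) : ℝ)) ^ 2) / (n : ℝ)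
        - ((∑ i, hv i ^ 2) / (n : ℝ)
          - ((∑ z ∈ (univ : Finset (Fin n)).offDiag, f z.1 z.2) / (n * (n - 1) : ℝ)) ^ 2)|
      ≤ 2 * Real.sqrt ((∑ i, hv i ^ 2) / (n : ℝ)
            * ((∑ i, ((∑ j ∈ univ.erase i, (f i j - hv i)) / ((n : ℝ) - 1)) ^ 2) / (n : ℝ)))
        + (∑ i, ((∑ j ∈ univ.erase i, (f i j - hv i)) / ((n : ℝ) - 1)) ^ 2) / (n : ℝ) := by
  have hn1 : 1 ≤ n := by omega
  have hmean : (∑ z ∈ (univ : Finset (Fin n)).offDiag, f z.1 z.2) / (n * (n - 1) : ℝ)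
      = (∑ i, (fun i => (∑ j ∈ univ.erase i, f i j) / ((n : ℝ) - 1)) i) / (n : ℝ) :=
    (sum_rowMean_div_eq_ustat f).symm
  rw [empVar_eq_meanSq_sub_sq hn1 (fun i => (∑ j ∈ univ.erase i, f i j) / ((n : ℝ) - 1)) hmean]
  simp only [rowMean_eq_add_err hn f hv]
  have e : (∑ i, (hv i + (∑ j ∈ univ.erase i, (f i j - hv i)) / ((n : ℝ) - 1)) ^ 2) / (n : ℝ)
        - ((∑ z ∈ (univ : Finset (Fin n)).offDiag, f z.1 z.2) / (n * (n - 1) : ℝ)) ^ 2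
        - ((∑ i, hv i ^ 2) / (n : ℝ)
          - ((∑ z ∈ (univ : Finset (Fin n)).offDiag, f z.1 z.2) / (n * (n - 1) : ℝ)) ^ 2)
      = (∑ i, (hv i + (∑ j ∈ univ.erase i, (f i j - hv i)) / ((n : ℝ) - 1)) ^ 2) / (n : ℝ)
        - (∑ i, hv i ^ 2) / (n : ℝ) := by ring
  rw [e]
  exact abs_meanSq_add_sub_meanSq_le hn1 hv fun i => (∑ j ∈ univ.erase i, (f i j - hv i))
    / ((n : ℝ) - 1)

/-- **The squeeze along a subsequence** (real analysis): if `Aₙ → c₁`, `Uₙ → m`, `E_{φ(k)} → 0`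
along some `φ → ∞`, and `|Vₙ − (Aₙ − Uₙ²)| ≤ 2√(AₙEₙ) + Eₙ` for `n ≥ 2`, then
`V_{φ(k)} → c₁ − m²`. [ours] -/
theorem tendsto_senVariance_along {V A U E : ℕ → ℝ} {φ : ℕ → ℕ} {c₁ m : ℝ}
    (hφ : Tendsto φ atTop atTop) (hA : Tendsto A atTop (𝓝 c₁)) (hU : Tendsto U atTop (𝓝 m))
    (hE : Tendsto (fun k => E (φ k)) atTop (𝓝 0))
    (hbound : ∀ n, 2 ≤ n → |V n - (A n - U n ^ 2)| ≤ 2 * Real.sqrt (A n * E n) + E n) :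
    Tendsto (fun k => V (φ k)) atTop (𝓝 (c₁ - m ^ 2)) := by
  have hA' : Tendsto (fun k => A (φ k)) atTop (𝓝 c₁) := hA.comp hφ
  have hU' : Tendsto (fun k => U (φ k)) atTop (𝓝 m) := hU.comp hφ
  have hB : Tendsto (fun k => 2 * Real.sqrt (A (φ k) * E (φ k)) + E (φ k)) atTop (𝓝 0) := by
    have h := ((hA'.mul hE).sqrt.const_mul 2).add hE
    simpa only [mul_zero, Real.sqrt_zero, add_zero] using h
  have hdiff : Tendsto (fun k => V (φ k) - (A (φ k) - U (φ k) ^ 2)) atTop (𝓝 0) := by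
    refine squeeze_zero_norm' ?_ hB
    filter_upwards [hφ.eventually (eventually_ge_atTop 2)] with k hk
    rw [Real.norm_eq_abs]
    exact hbound _ hk
  have hlim := hdiff.add (hA'.sub (hU'.pow 2))
  simp only [sub_add_cancel, zero_add] at hlim
  exact hlim

end Deterministic

/-! ## §2 The conditionally centred kernel `G̃(a, b) = F(a, b) − h(a)` -/

section Centred

variable {X : Type*} [MeasurableSpace X] {ν : Measure X} [IsProbabilityMeasure ν] {F : X → X → ℝ}

omit [IsProbabilityMeasure ν] in
/-- `G̃` is measurable. [ours] -/
theorem measurable_centredKernel [SFinite ν] (hFm : Measurable fun z : X × X => F z.1 z.2) :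
    Measurable fun z : X × X => F z.1 z.2 - ∫ b, F z.1 b ∂ν :=
  hFm.sub ((stronglyMeasurable_condMean hFm).measurable.comp measurable_fst)

/-- `G̃ ∈ L²(ν ⊗ ν)`. [ours] -/
theorem memLp_centredKernel_two (hFm : Measurable fun z : X × X => F z.1 z.2)
    (hF2 : MemLp (fun z : X × X => F z.1 z.2) 2 (ν.prod ν)) :
    MemLp (fun z : X × X => F z.1 z.2 - ∫ b, F z.1 b ∂ν) 2 (ν.prod ν) :=
  hF2.sub (memLp_condMean_fst_snd hFm hF2).1

/-- **`G̃` is conditionally centred at EVERY point**: `∫ (F(a, b) − h(a)) dν(b) = 0` for all `a`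
(where `F(a, ·) ∈ L¹(ν)` it is `h(a) − h(a)`; where it is not, `F(a, ·) − h(a)` is not
integrable either, so both sides are `0` by Lean's convention). [ours] -/
theorem integral_centredKernel_section_eq_zero (a : X) :
    ∫ b, (F a b - ∫ b', F a b' ∂ν) ∂ν = 0 := by
  by_cases hFa : Integrable (fun b => F a b) ν
  · rw [integral_sub hFa (integrable_const _), integral_const, smul_eq_mul, probReal_univ,
      one_mul, sub_self]
  · refine integral_undef fun hint => hFa ?_
    have e : (fun b => F a b) = fun b => (F a b - ∫ b', F a b' ∂ν) + ∫ b', F a b' ∂ν := by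
      funext b
      ring
    rw [e]
    exact hint.add (integrable_const _)

/-- `∫ (∫ G̃(a, b) dν(b))² dν(a) = 0` — the shared-index moment of `G̃` vanishes. [ours] -/
theorem integral_sq_centredKernel_section_eq_zero :
    ∫ a, (∫ b, (F a b - ∫ b', F a b' ∂ν) ∂ν) ^ 2 ∂ν = 0 := by
  simp only [integral_centredKernel_section_eq_zero, zero_pow two_ne_zero, integral_zero]

end Centred

end Summit.Ventures.LatticeQCDFlow.Scoring.CardConsistency

end
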